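import Summits.HodgeConjecture.HodgeConjecture.Theorems.F0P6aLineSpecialisation
import Summits.HodgeConjecture.HodgeConjecture.Theorems.F0P6aStubFROBRoofLegs
import Summits.HodgeConjecture.HodgeConjecture.Theorems.F0P6aKillEngine
import Summits.HodgeConjecture.HodgeConjecture.Theorems.F0P6aKillEngineW
import Summits.HodgeConjecture.HodgeConjecture.Theorems.F0P6aRoofKernelCount
import Summits.HodgeConjecture.HodgeConjecture.Theorems.F0P6aRoofWCounts
import Summits.HodgeConjecture.HodgeConjecture.Theorems.F0P6aSpecOrgansU
import Summits.HodgeConjecture.HodgeConjecture.Theorems.F0P6aImgSection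
import Summits.HodgeConjecture.HodgeConjecture.Theorems.F0P6aRoofLegsFinImage
import Literature.AlgebraicGeometry.AbelianSchemes.RoofLegsSpecialFibreKernelRows
import Literature.AlgebraicGeometry.AbelianSchemes.RoofLegsSpecialFibreKernelRowsFin
import Literature.AlgebraicGeometry.AbelianSchemes.KerPointsCountOfKernelClause
import Literature.AlgebraicGeometry.GroupSchemes.KernelRealisationRank
import Literature.AlgebraicGeometry.AbelianSchemes.RoofLegsIsogenyOfPolarization
import Literature.AlgebraicGeometry.Resolution.ReducedOfSmoothOverReduced
import Literature.AlgebraicGeometry.AbelianSchemes.PolarizationUnitHypothesis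
import Literature.AlgebraicGeometry.Motives.GoodReductionCechProofs
import HarnessLib
import HarnessLib.Audit.LibrarySuggestionsDenyListCruxes

/-!
# `F0P6aStubRHO1K4Seam` — ★ RE-HOME of `Lines/F0_P6a_StubRHO1.lean` (tree sha16 ce86702e556aed39, 1561 l.), PART 1 of 6 — tree lines :1–:333
K6 verbatim twin (L2 column; pen LA2-plan (g5) PLAN v1.3 Δ5 cut set of record [334, 601, 862, 1198, 1472]; hand LA2-p02 (g5), `mkparts2.py` cand.v3d1.LA2-p02g5): the code below this header is the tree bytes
of the stated range untouched, namespace KEPT (every fully-qualified name unchanged); later parts re-open the scopes live at their first line with their `open` ∕ `variable` ∕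
`universe` ∕ section `set_option` lines replayed verbatim (certified by one-file split rehearsal, LA2-p02 TABLE v2∕v3).  Header canonical per LEAD «M-142a» (A): bare imports only.

(d1) PRE-CURE (pen LA2-plan (g5) RULING R5 00:47:08Z, «M-142e» class (d1); LA2-p03 cone-dedup census 9936b54d): the tree՚s two restatements of ★ decls are DELETED — :162–:166 `act₀Of_hom_hom_hom_eq՚` (≡ ★ `…Cruxes.HLiu418.F0P6aRoofCwKernel.act₀Of_hom_hom_hom`, `rfl` law; 0 call sites in this module, so no import is added) and :703–:730 `roofΩ_legs_isFinite_surjective` («BY COPY of L3 W1»; ≡ ★ `…Cruxes.HLiu418.F0P6aStubFROBRoofLegs.roofΩ_legs_isFinite_surjective` in `Theorems/F0P6aStubFROBRoofLegsKernelRows.lean`, already in the import closure via ★ `Theorems.F0P6aStubFROBRoofLegs`); its one call site :830 spells that FQN; line numbers below refer to the cured text (tree minus 35 l.); every other byte is the tree՚s.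
## Import provenance — ★ twin stems (LAST part, plain stem) replacing `Cruxes.HLiu418.Lines` imports: `F0P6aLineSpecialisation` ← `Lines.F0_P6a_LineSpecialisation`;
  `F0P6aStubFROBRoofLegs` ← `Lines.F0_P6a_StubFROBRoofLegs`; `F0P6aKillEngine` ← `Lines.F0_P6a_KillEngine`;
  `F0P6aKillEngineW` ← `Lines.F0_P6a_KillEngineW`; `F0P6aRoofKernelCount` ← `Lines.F0_P6a_RoofKernelCount`;
  `F0P6aRoofWCounts` ← `Lines.F0_P6a_RoofWCounts`; `F0P6aSpecOrgansU` ← `Lines.F0_P6a_SpecOrgansU`; `F0P6aImgSection` ← `Lines.F0_P6a_ImgSection`;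
  `F0P6aRoofLegsFinImage` ← `Lines.F0_P6a_RoofLegsFinImage`.
`import HarnessLib.Audit.LibrarySuggestionsDenyListCruxes` kept on this ROOT part per LEAD «M-142d» «P-κ» (parts 2… inherit it); every other import = the tree list made bare
(the trailing provenance comments of 8 import lines stay in the tree file `Lines/F0_P6a_StubRHO1.lean` ll. 1–19).
Original module docstring: reproduced verbatim below this header block (part of the tree bytes :1–:333).  HC_CM is proved only modulo the 7 printed citations (2 remaining: hLiu418 = stmt-HodgeConjecture-24832, h413 = stmt-HodgeConjecture-24833) until rung 0 closes; a re-home is count-neutral.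
-/

/-!
# (ρ1𝒞) «THE REDUCED LEG q̄ OF THE CANONICAL ROOF» — `exists_quotLegReduction` = the `stub_RHO1` socket, v6 (0 sorry; pen LA1-p01 (g4) since LA1-plan (g5) 13:43:24Z)

v6 (LA1-p01 (g4), 2026-09-02 15:19Z; draft 10 = + LA1-p02 (g4) SEALED-DOCK v2 `section DockRow` (chain `dockSeal₁∕₂∕₃` + `dock_row_of_kerRow_unseal`, max 197 752 hb) replacing v5's 389 491-hb `dock_row_of_kerRow` per LA1-plan (g5) 15:19:42Z (4); HOME `F0/P6/L1/LA1-p01/g4/QuotLegReduction.v6.*.LA1-p01g4.lean`; tree home `Lines/F0_P6a_StubRHO1.lean` = (W4b), LA2-plan (g2)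
RULINGS 11:17:16Z (3) ∕ 14:10:00Z ∕ GATE LAWS 14:20:43Z (L1)(L2)(L3)): rc 0 ∕ errors [] ∕ warnings [] ∕ SORRIES 0 ∕ axioms of the HEAD = [propext, Classical.choice,
Quot.sound] ∕ every decl ≤ 400 000.  WHAT CHANGED FROM v5: imports += served PART C `SpecOrgansU` (§ HD `hD_of_inputs`, § Jφ) and § IMG `ImgSection` (`row_IMG`);
v5's § HD by-copy twins and v4's §A (b)(b′)(c′) producers DELETED; **§A = ④-bis `exists_roofLeg_of_legs_kerRowsFin_image`** (A-p06 (g37) v9: ONE decl, instance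
BINDERS; TEMP PASTE of leaflet cand v3 7901fcc6 (the (W4a) bytes of record) — at (W4a) `Lines/F0_P6a_RoofLegsFinImage.lean` BUILT the paste section becomes that `import` and the ★
`…RoofLegsSpecialFibreKernelRowsFinImage` import is dropped, no other byte change); **§A.1 `exists_roofLeg_kerRowsFin_image_of_dlineLegs`** — ④-bis re-exported at the
D-LINE `RoofΩ` rows (instances from ④ (a), (r5) respell by ★ `LevelStructure.baseChange_section_`, ④-bis's two instances passed as the LITERAL terms `I.comm`∕`h𝓨.2`
via `@` so its ten-row conclusion unifies syntactically — A-p06's 14:03Z diagnostic); **§J THE ROWS IN BINDER FORM** (LA1-plan 13:43:24Z (a); (L1): the chosen leg is a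
BOUND witness, never a `def` over `.choose`): `rho1_rowsA_of_leg` (`∃ (_ : IsMonHom ψ), FLAT ∧ ACT ∧ LVL ∧ SIM ∧ K2-gen`), `rho1_rowRK_of_leg`, `rho1_rowKILL_of_leg`,
`rho1_rowDOCK_of_leg`, `rho1_rowIMG_of_leg` — each over the junction's binders PRUNED to what it reads, the leg under TWO NAMES tied by `hq : qb = qbR` (`qbR` at ④-bis's
RAW carrier for the row BINDERS, whose texts are ④-bis's conjuncts VERBATIM — syntactic against `H.choose_spec`; `qb` at the SOCKET carrier for the conclusion, the
socket conjunct VERBATIM — syntactic against the goal; proof `subst hq` + ONE call of the v5 row lemma: `rk_row_of_kerRow` ∘ RKC `natCard_roofKernel_eq`,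
`kill_row_of_kerRow_sigma` + `sigma_pins`, `dock_row_of_legs_sigma`, served `row_IMG` + PART C `imgLine_quotΩ_quotΩ_eq_translΩ_assembled` with `hpN :=`
LS `coprime_pChar_N_of_specialPoint I (red₀Of … y) (I.hg ▸ Module.finrank_pos)` and `I.hunr`); the JUNCTION `exists_quotLegReduction_of_legs` (v5 signature) =
`have H := exists_roofLeg_kerRowsFin_image_of_dlineLegs …` + five calls `… H.choose H.choose rfl H.choose_spec.…` + the socket tuple; HEAD = v5 bytes (statement = tree
LEAF ED. 4 ac962666 `stub_RHO1` :1104 token for token).  MEASURED ON THE WAY (wallified probe): junction statement 124 k, ④-bis 135 k, the five calls ≈ 2 k each once the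
row binders are in ④-bis's text; a RAW-typed leg in the conclusions costs > 218 k in the tuple, a socket-typed leg in the hypotheses ≈ 65 k per call — hence two names.
HC_CM is proved only modulo the 7 printed citations (2 remaining: hLiu418 = stmt-HodgeConjecture-24832, h413 = stmt-HodgeConjecture-24833) until rung 0 closes; count-neutral.

(LA1-p02 (g3)'s v5 header follows, for the record.)

# (ρ1𝒞) — v5 (LA1-p02 (g3), PEN OF RECORD per LA1-plan (g5) 11:13:34Z ∕ LA2-plan (g2) 11:17:16Z)

HOME-first ONE FILE OF RECORD `F0/P6/L1/LA1-p02/g3/QuotLegReduction.v5.LA1-p02g3.lean`; ns `…F0P6aLineSpecialisation`; tree home (at 0 sorry, v6) = own leaflet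
`Lines/F0_P6a_StubRHO1.lean` (LA2-plan ruling (3)).  BASE := LA5-plan (g4) probe `QuotLegReduction.v4.cap400k.probe` 28a5dee614b1f056 (= LA1-p01 (g3) v4 58a574e5 with every
`maxHeartbeats` at 400 000; rc 0 ∕ sorries 2 ∕ 230.7 s) BY COPY, then (LA1-plan 11:18:13Z): rows FOLDED as ONE-LINE CALLS of the row lemmas pasted ABOVE the junction.
v5 AS SHIPPED (LA1-plan (g5) chair rule 12:56:13Z; farm rc 0 ∕ sorries 1 decl ∕ 454.7 s lean-4 ∕ axioms of the head = TRIO ∪ {sorryAx}): ONE-DECL junction of the v4 shape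
(base 28a5dee6), (b′) = v4 §A copy (★ `…KernelRows`), with (FLAT-SURJ)(ACT)(LVL)(SIM) folded (v4) + **(K2-gen) FOLDED INLINE** (RKC `isIdealTorsionΩ_mul_of_roofLink … I.hunr … ⟨hKL, hRoof⟩`
∘ (r1) ∘ (b′)'s (K2₀); LA5-p01 (g5) pattern) + `sigma_pins` PAID (`⟨(isoGenericOf_inv I y).trans rfl, (isoSpecialOf_inv I y).trans rfl⟩`, LS ED. 3 served) + `hD := hD_of_inputs I`
PAID + binder `hRoof` (head passes `hK.2`) + FIX-2 frame (`[IsGalois ℚ F]` = §Σ′ binder #5; LA4-p04 strict twin shape).  FOUR NAMED HOLES in the junction, each with its GREEN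
standalone lemma pasted in §ROWS and the exact call term in the bullet comment: (RK) `rk_row_of_kerRow` 2a9ce941 (needs the Fin producer ④ as `H`), (KILL) `kill_row_of_kerRow`
f2365bf0 (pins inlined, 29.9 s TRIO — its in-junction fold measured RED: «isDefEq 400 000», ship variant S2), (DOCK) `dock_row_of_legs_sigma` 631f50f7 (103 s TRIO), (IMG) served § IMG
`row_IMG` + § Jφ + ④-bis.  WHY HOLES AND NOT FOLDS: measured 11:38Z–13:34Z — every in-junction call of a socket-currency row lemma costs > 200 000 heartbeats (KILL alone > 400 000),
and the per-row-decl cut (§B′: `ψOf` + nine `row_*` decls; evidence file `QuotLegReduction.v5.Bprime-percut.rc1.evidence.LA1-p02g3.lean`) times out at `whnf` 400 000 AT THE STATEMENT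
of every row carrying the leg under `≫` (heads'-typed AND raw-typed `ψOf`, served ④ AND a local ④ copy — all four variants), so under the 400 000 law the remaining folds need a
different statement technology (A-p06 (g37) 13:04Z `LegsRowsFinImage` PREDICATE cut, or LA5-p01 (g5) wallify-guided single folds) — handed to the heir with the numbers.
HC_CM is proved only modulo the 7 printed citations (2 remaining: hLiu418 = stmt-HodgeConjecture-24832, h413 = stmt-HodgeConjecture-24833) until rung 0 closes; count-neutral, HOME-only.

(LA1-p01 (g3)'s v4 header follows, for the record.)
-/


/-
# LS LEAFLET (HOME cand, LA1-p01 g3): (ρ1𝒞) `exists_quotLegReduction` — THE REDUCED LEG `ψ : A_{red₀ y} → 𝒞_{red₀ (quotΩ y L)}` INTO THE SERRE-TWIST FAMILY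
# `𝒞 := I.univ ⊗_𝒪 𝔭_w⁻¹`, with the DOCK rows — STATEMENT FIRST

HOME-first candidate (LA2-plan (g2) RULINGS #3 (4) «𝒞-LEG» 2026-09-02T07:30:42Z → LA1-p01 (g3)); namespace `Summit.HodgeConjecture.HodgeConjecture.Cruxes.HLiu418.F0P6aLineSpecialisation`;
imports the SERVED LS leaflet ED. 2 + ★ only; no filing (pastes into the leaflet).  HC_CM is proved only modulo the 7 printed citations (2 remaining: hLiu418 =
stmt-HodgeConjecture-24832, h413 = stmt-HodgeConjecture-24833) until rung 0 closes.

v3 (10:05Z): §B head = `stub_RHO1` socket text be4dc9fa :1100–:1169 VERBATIM (statement-first, body `sorry`).  CENSUS (LA1-p01 07:45Z∕07:50Z on the L2 bus): rows (MON)(FLAT-SURJ)(ACT)(LVL)(SIM)(K3-gen)(K2-gen) below are EXACTLY the rows of ★ LA1-p04∕LA3-p01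
`exists_roofLeg_specialFibre_of_downstairsDual_kerRows` at the D-line binders, i.e. «L3» W1 `roofLegs_of_roofLink` (LA3-p01 (g2) ROOF-LEGS leaflet cand v3 §3–§4, ED. 2 = kerRows call)
— IMPORT, DON'T RESTATE once `Lines/F0_P6a_StubFROBRoofLegs.lean` is served (until then §A of the proof edition carries W1 §3–§4 BY COPY); rows (KILL)(DOCK) are the L2-only
content (LA1-p02 (g2) a67f871b :1003 token shapes), (KILL) ⇐ (K3-gen) at the flat closure of the line's admissible ideal (★ `AdmissibleIdealClosureSubscheme` + §1c∕§1d),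
(DOCK) ⇐ (KILL) + ranks ((k2b), open) + ★ `KernelRecognitionByRank`.  Body `sorry` in this statement-first edition.
-/


set_option autoImplicit false
set_option linter.dupNamespace false

noncomputable section

namespace Summit.HodgeConjecture.HodgeConjecture.Cruxes.HLiu418.F0P6aLineSpecialisation

open CategoryTheory CategoryTheory.Limits NumberField IsDedekindDomain MulAction AlgebraicGeometry
open scoped Matrix Polynomial Pointwise MonoidalCategory
open Literature.NumberTheory.GaloisRepresentations
open Literature.NumberTheory.Automorphic Literature.NumberTheory.Automorphic.UnitaryGroup
open Literature.AlgebraicGeometry.ShimuraVarieties.UnitaryCanonicalModel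
open Literature.NumberTheory.Automorphic.Liu2021.AppendixC
open Literature.AlgebraicGeometry.Motives (AlgPoints IntegralModel SchemeOver thickening thickeningGalAction thickeningLift specOver extendPoint
  specValuationSubring specFractionFieldι specRingHomι)
open Literature.NumberTheory.EllipticCurves (genericFibre specGenericPoint)
open Literature.NumberTheory.DiophantineGeometry (geomResidueField specialFibreFunctor specResidueField geomClosedPointIsoSpecResidueField
  toClosureValuationSubring)
open Literature.AlgebraicGeometry.RelativeSpec (ActionOver)
open Literature.AlgebraicGeometry.AbelianSchemes Literature.AlgebraicGeometry.AbelianSchemes.AbelianSchemeOver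
open Literature.AlgebraicGeometry.GroupSchemes.AffineGroupScheme (Alg quotIncl)
open Summit.HodgeConjecture.HodgeConjecture.Cruxes.HLiu418.F0P6aModuliDatumDefs
open Summit.HodgeConjecture.HodgeConjecture.Cruxes.HLiu418.F0P6aRGDAssembly
open Summit.HodgeConjecture.HodgeConjecture.Cruxes.HLiu418.F0P6aDatumOfInputs

section QuotLegReduction

open scoped MonObj CategoryTheory.Obj

-- the frame of the D-line՚s `Letters` section VERBATIM
variable {F : Type} [Field F] [NumberField F] [IsCMField F] {ι₁ : F →+* ℂ}
    {Jstar : Matrix (Fin 2) (Fin 2) F}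
    {K₀ : C5.OpenCompactSubgroup ↥(finAdelic ↥(maximalRealSubfield F) F (IsCMField.complexConj F) 2 Jstar)}
    {S : RecordSystemGS F Jstar ι₁ K₀} {hU7ₛ : S.HeckeTranslateDefinedOver}
    {hJ : (Jstar.map (IsCMField.complexConj F))ᵀ = Jstar} {hJu : IsUnit Jstar}
    {Fi : Type} [Field Fi] [Algebra F Fi] {Kc : C5.SmallLevel K₀} {G : Type} [Group G]
    {𝓜 : IntegralModel (𝓞 F) F ((thickening F Fi).obj (S.M.obj Kc))}
    {w : HeightOneSpectrum (𝓞 F)} {hw : (IsCMField.complexConj F) • w ≠ w} {h𝓨 : (𝓜.localise w).IsSmoothProper 1}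
    {θ : ActionOver (𝓜.localise w).total.hom ((Fi ≃ₐ[F] Fi) × G)}
    {e : Fi →ₐ[F] AlgebraicClosure (w.adicCompletion F)}

set_option backward.isDefEq.respectTransparency false

/-! ### §ROWS — the row lemmas (pasted HOME bytes, each GREEN + TRIO on the served oleans; see the module docstring for shas) -/

/-! (v6) § HD `isReduced_total_of_isSmoothProper` ∕ `hD_of_inputs` are SERVED by PART C `Lines/F0_P6a_SpecOrgansU.lean` (same FQNs) — the by-copy twins of v5 :100–:118 are DELETED (LA1-p03 (g5) closure census 13:44:47Z). -/

section K4Seam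

open scoped MonObj CategoryTheory.Obj
open Literature.AlgebraicGeometry.GroupSchemes (GroupSchemeKernel.ker)

variable (I : RGDInputsAt F ι₁ Jstar K₀ S hU7ₛ hJ hJu Fi Kc G 𝓜 w hw h𝓨 θ e)
    {m : ℕ} (E' : Matrix (Fin m) (Fin m) (𝓞 F)) (hE' : E' * E' = E')
    (y y'' : AlgPoints (S.M.obj Kc) (AlgebraicClosure (w.adicCompletion F)))
    {B : AbelianSchemeOver (Spec (CommRingCat.of (AlgebraicClosure (w.adicCompletion F))))}
    (q : (schΩOf S Kc 𝓜 w e I.univ y).X ⟶ B.X)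
    -- `q̄` in ★'s ∕ W1-a's spelling (the properness instance is `h𝓨.2`, as in (b′) and in `red₀Of`)
    (qbar : haveI := I.comm
      haveI : IsProper (𝓜.localise w).total.hom := h𝓨.2
      ((I.univ.baseChange (pullback.fst (𝓜.localise w).total.hom (specResidueField w))).baseChange ((𝓜.localise w).geomReductionMap (thickeningLift e (S.M.obj Kc) y)).left).X ⟶
        (((serreTensor I.act E' hE').baseChange (pullback.fst (𝓜.localise w).total.hom (specResidueField w))).baseChange ((𝓜.localise w).geomReductionMap (thickeningLift e (S.M.obj Kc) y'')).left).X)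

/-- **(r4₀-q) ⟹ `hr4`** (∃-form of `hL_sch₀Of_tied_of_counts` ∕ W7 §6a ∕ GAP-2; witness `b := ι^𝒞(a)`; DEFEQ). [cite: Kottwitz1992, §5, p. 390] [cite: Liu2021, Prop. D.8 (3) p. 137] -/
theorem hr4_of_kerRow
    (hact₀ : haveI := I.comm
      haveI : IsProper (𝓜.localise w).total.hom := h𝓨.2
      ∀ a : 𝓞 F, ((I.act.baseChange (pullback.fst (𝓜.localise w).total.hom (specResidueField w))).baseChange ((𝓜.localise w).geomReductionMap (thickeningLift e (S.M.obj Kc) y)).left).i a ≫ qbar =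
        qbar ≫ (((serreAction I.act E' hE').baseChange (pullback.fst (𝓜.localise w).total.hom (specResidueField w))).baseChange ((𝓜.localise w).geomReductionMap (thickeningLift e (S.M.obj Kc) y'')).left).i a) :
    haveI := I.comm
    ∀ a : 𝓞 F, ∃ b : (sch₀Of 𝓜 w (serreTensor I.act E' hE') (red₀Of S Kc 𝓜 w h𝓨 e y'')).X ⟶ (sch₀Of 𝓜 w (serreTensor I.act E' hE') (red₀Of S Kc 𝓜 w h𝓨 e y'')).X,
      (act₀Of 𝓜 w I.univ I.act a (red₀Of S Kc 𝓜 w h𝓨 e y)).hom.hom.hom ≫ (qbar : (sch₀Of 𝓜 w I.univ (red₀Of S Kc 𝓜 w h𝓨 e y)).X ⟶ (sch₀Of 𝓜 w (serreTensor I.act E' hE') (red₀Of S Kc 𝓜 w h𝓨 e y'')).X) = qbar ≫ b :=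
  fun a => ⟨_, hact₀ a⟩

/-- Generic: an intertwiner `α ≫ q = q ≫ β` with `β` a homomorphism turns `z ≫ q = 1` into `z ≫ α ≫ q = 1` (any cartesian monoidal category; proved once at the
abstract objects so that no scheme-level unfolding is ever asked of the unifier). [cite: MumfordFogartyKirwan1994, Ch. 7 §2 Definition 7.2 (p. 129)] -/
theorem comp_comp_eq_one_of_intertwine {C : Type*} [Category C] [CartesianMonoidalCategory C] {A M T : C} [MonObj M]
    (α : A ⟶ A) (q : A ⟶ M) (β : M ⟶ M) [IsMonHom β] (h : α ≫ q = q ≫ β) (z : T ⟶ A) (hz : z ≫ q = 1) : z ≫ α ≫ q = 1 := by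
  rw [h, reassoc_of% hz, MonObj.one_comp]

set_option maxHeartbeats 400000 in
/-- **(r4₀-q) ⟹ `hqι`** (the multiplicative form: `z ≫ q̄ = 1 ⇒ z ≫ ι(a) ≫ q̄ = 1`; `ι^𝒞(a)` is a homomorphism, ★ `RingAction.isMonHom`). [cite: Kottwitz1992, §5, p. 390]
[cite: Liu2021, Prop. D.8 (3) p. 137] -/
theorem hqι_of_kerRow
    (hact₀ : haveI := I.comm
      haveI : IsProper (𝓜.localise w).total.hom := h𝓨.2
      ∀ a : 𝓞 F, ((I.act.baseChange (pullback.fst (𝓜.localise w).total.hom (specResidueField w))).baseChange ((𝓜.localise w).geomReductionMap (thickeningLift e (S.M.obj Kc) y)).left).i a ≫ qbar =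
        qbar ≫ (((serreAction I.act E' hE').baseChange (pullback.fst (𝓜.localise w).total.hom (specResidueField w))).baseChange ((𝓜.localise w).geomReductionMap (thickeningLift e (S.M.obj Kc) y'')).left).i a) :
    haveI := I.comm
    ∀ (a : 𝓞 F) ⦃T : SchemeOver (geomResidueField w)⦄ (z : T ⟶ (sch₀Of 𝓜 w I.univ (red₀Of S Kc 𝓜 w h𝓨 e y)).X),
      z ≫ (qbar : (sch₀Of 𝓜 w I.univ (red₀Of S Kc 𝓜 w h𝓨 e y)).X ⟶ (sch₀Of 𝓜 w (serreTensor I.act E' hE') (red₀Of S Kc 𝓜 w h𝓨 e y'')).X) = 1 →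
        z ≫ (act₀Of 𝓜 w I.univ I.act a (red₀Of S Kc 𝓜 w h𝓨 e y)).hom.hom.hom ≫
          (qbar : (sch₀Of 𝓜 w I.univ (red₀Of S Kc 𝓜 w h𝓨 e y)).X ⟶ (sch₀Of 𝓜 w (serreTensor I.act E' hE') (red₀Of S Kc 𝓜 w h𝓨 e y'')).X) = 1 := by
  intro a T z hz
  haveI := I.comm
  -- `ι^𝒞(a)` is a homomorphism, instance stated at the heads' (`sch₀Of`) spelling of its carrier
  haveI : IsMonHom ((((serreAction I.act E' hE').baseChange (pullback.fst (𝓜.localise w).total.hom (specResidueField w))).baseChange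
      (red₀Of S Kc 𝓜 w h𝓨 e y'').left).i a :
      (sch₀Of 𝓜 w (serreTensor I.act E' hE') (red₀Of S Kc 𝓜 w h𝓨 e y'')).X ⟶ (sch₀Of 𝓜 w (serreTensor I.act E' hE') (red₀Of S Kc 𝓜 w h𝓨 e y'')).X) :=
    (((serreAction I.act E' hE').baseChange (pullback.fst (𝓜.localise w).total.hom (specResidueField w))).baseChange (red₀Of S Kc 𝓜 w h𝓨 e y'').left).isMonHom a
  -- (r4₀-q) read at `x̄ := red₀Of … y` in the heads' currency (`act₀Of….hom.hom.hom`∕`red₀Of` by `rfl`: only those δ-steps are asked of the unifier)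
  have h : (act₀Of 𝓜 w I.univ I.act a (red₀Of S Kc 𝓜 w h𝓨 e y)).hom.hom.hom ≫
      (qbar : (sch₀Of 𝓜 w I.univ (red₀Of S Kc 𝓜 w h𝓨 e y)).X ⟶ (sch₀Of 𝓜 w (serreTensor I.act E' hE') (red₀Of S Kc 𝓜 w h𝓨 e y'')).X) =
      (qbar : (sch₀Of 𝓜 w I.univ (red₀Of S Kc 𝓜 w h𝓨 e y)).X ⟶ (sch₀Of 𝓜 w (serreTensor I.act E' hE') (red₀Of S Kc 𝓜 w h𝓨 e y'')).X) ≫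
        ((((serreAction I.act E' hE').baseChange (pullback.fst (𝓜.localise w).total.hom (specResidueField w))).baseChange (red₀Of S Kc 𝓜 w h𝓨 e y'').left).i a :
          (sch₀Of 𝓜 w (serreTensor I.act E' hE') (red₀Of S Kc 𝓜 w h𝓨 e y'')).X ⟶ (sch₀Of 𝓜 w (serreTensor I.act E' hE') (red₀Of S Kc 𝓜 w h𝓨 e y'')).X) :=
    hact₀ a
  exact comp_comp_eq_one_of_intertwine _ _ _ h z hz

/-- **(K2-gen) ⟹ `hkerq`** at `𝔞 := 𝔭_w·𝔭_{c•w}`: the upstairs premiss «every `Ω̄`-point of `A_y` killed by `q` is `𝔭_w 𝔭_{c•w}`-torsion» is (r1) `Ker q(Ω̄) = K` + «`K ⊆ A_y[𝔭_w 𝔭_{c•w}]`»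
(LA2-p03's (ρ2″)-C `isIdealTorsionΩ_mul_of_roofLink`, taken as the binder `hKtors`); `IsIdealTorsionΩ` and `(actΩOf …).hom.hom.hom` unfold to ★'s tokens by `rfl`.
[cite: Liu2021, Prop. D.8 (2) p. 135] [cite: SerreTate1968, §1 Lemma 2] -/
theorem hkerq_of_kerRow
    (K : Subgroup ((fibreΩOf S Kc 𝓜 w e I.univ y).Points (AlgebraicClosure (w.adicCompletion F))))
    (r1 : ∀ P : (fibreΩOf S Kc 𝓜 w e I.univ y).Points (AlgebraicClosure (w.adicCompletion F)),
      (AlgPoints.map q P : B.toAffine.toAbelianVariety.Points (AlgebraicClosure (w.adicCompletion F))) = 1 ↔ P ∈ K)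
    (hKtors : ∀ P ∈ K, IsIdealTorsionΩ S Kc 𝓜 w e I.univ I.act y (w.asIdeal * ((IsCMField.complexConj F) • w).asIdeal) P)
    (hK2 : haveI := I.comm
      haveI : IsProper (𝓜.localise w).total.hom := h𝓨.2
      ∀ 𝔞 : Ideal (𝓞 F),
        (∀ Pt : ((I.univ.baseChange ((𝓜.localise w).genericIso'.inv.left ≫ pullback.fst (𝓜.localise w).total.hom (specGenericPoint (HeightOneSpectrum.valuationSubringAtPrime F w) F))).baseChange
            (thickeningLift e (S.M.obj Kc) y).left).toAffine.toAbelianVariety.Points (AlgebraicClosure (w.adicCompletion F)),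
          (AlgPoints.map q Pt : B.toAffine.toAbelianVariety.Points (AlgebraicClosure (w.adicCompletion F))) = 1 →
            ∀ r ∈ 𝔞, (AlgPoints.map (((I.act.baseChange ((𝓜.localise w).genericIso'.inv.left ≫ pullback.fst (𝓜.localise w).total.hom (specGenericPoint (HeightOneSpectrum.valuationSubringAtPrime F w) F))).baseChange (thickeningLift e (S.M.obj Kc) y).left).i r) Pt :
              ((I.univ.baseChange ((𝓜.localise w).genericIso'.inv.left ≫ pullback.fst (𝓜.localise w).total.hom (specGenericPoint (HeightOneSpectrum.valuationSubringAtPrime F w) F))).baseChange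
                (thickeningLift e (S.M.obj Kc) y).left).toAffine.toAbelianVariety.Points (AlgebraicClosure (w.adicCompletion F))) = 1) →
        ∀ ⦃T : Over (Spec (.of (geomResidueField w)))⦄ (z : T ⟶ ((I.univ.baseChange (pullback.fst (𝓜.localise w).total.hom (specResidueField w))).baseChange ((𝓜.localise w).geomReductionMap (thickeningLift e (S.M.obj Kc) y)).left).X),
          z ≫ qbar = 1 → ∀ r ∈ 𝔞, z ≫ ((I.act.baseChange (pullback.fst (𝓜.localise w).total.hom (specResidueField w))).baseChange ((𝓜.localise w).geomReductionMap (thickeningLift e (S.M.obj Kc) y)).left).i r = 1) :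
    haveI := I.comm
    ∀ ⦃T : SchemeOver (geomResidueField w)⦄ (z : T ⟶ (sch₀Of 𝓜 w I.univ (red₀Of S Kc 𝓜 w h𝓨 e y)).X),
      z ≫ (qbar : (sch₀Of 𝓜 w I.univ (red₀Of S Kc 𝓜 w h𝓨 e y)).X ⟶ (sch₀Of 𝓜 w (serreTensor I.act E' hE') (red₀Of S Kc 𝓜 w h𝓨 e y'')).X) = 1 →
        ∀ b ∈ w.asIdeal * ((IsCMField.complexConj F) • w).asIdeal, z ≫ (act₀Of 𝓜 w I.univ I.act b (red₀Of S Kc 𝓜 w h𝓨 e y)).hom.hom.hom = 1 :=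
  hK2 (w.asIdeal * ((IsCMField.complexConj F) • w).asIdeal) (fun Pt hPt r hr => hKtors Pt ((r1 Pt).1 hPt) r hr)

/-- **(FIN) ⟹ `hfin`** (domain respell only: `sch₀Of`∕`red₀Of` unfold to ★'s carriers). [cite: MumfordAV1970, §7 Thm. 4 (p. 72)] -/
theorem hfin_of_kerRow (hfin : IsFinite qbar.left) :
    haveI := I.comm
    IsFinite (qbar : (sch₀Of 𝓜 w I.univ (red₀Of S Kc 𝓜 w h𝓨 e y)).X ⟶ (sch₀Of 𝓜 w (serreTensor I.act E' hE') (red₀Of S Kc 𝓜 w h𝓨 e y'')).X).left :=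
  hfin

/-- **(RK) + (r1) + «`#K = p^{2f}`» ⟹ `hrkK`**: `rk_κ̄ Γ(Ker q̄) = #Ker q(Ω̄) = #K = p^{2f} = p^f·p^f` (★ p850619 `natCard_kerPoints_eq_mul_self_of_forall_iff_of_natCard_eq_pow_two_mul`; the count
`hcardK` is LA2-p03's `natCard_roofKernel_eq`, a BINDER here). [cite: MumfordAV1970, §7 Thm. 4 (p. 72)] [cite: Liu2021, Prop. D.8 (2)(3) p. 135] -/
theorem hrkK_of_kerRow [IsMonHom q]
    (K : Subgroup ((fibreΩOf S Kc 𝓜 w e I.univ y).Points (AlgebraicClosure (w.adicCompletion F))))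
    (r1 : ∀ P : (fibreΩOf S Kc 𝓜 w e I.univ y).Points (AlgebraicClosure (w.adicCompletion F)),
      (AlgPoints.map q P : B.toAffine.toAbelianVariety.Points (AlgebraicClosure (w.adicCompletion F))) = 1 ↔ P ∈ K)
    (hcardK : Nat.card ↥K = I.pChar ^ (2 * I.fDeg))
    (hRK : haveI := I.comm
      haveI : IsProper (𝓜.localise w).total.hom := h𝓨.2
      Module.finrank (geomResidueField w) (Alg (GroupSchemeKernel.ker qbar)) =
        Nat.card (Literature.AlgebraicGeometry.Motives.AbelianVariety.Hom.kerPoints (specOver (AlgebraicClosure (w.adicCompletion F)) (AlgebraicClosure (w.adicCompletion F))) (homOfIsMonHom q))) :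
    haveI := I.comm
    Module.finrank (geomResidueField w)
        (Alg (GroupSchemeKernel.ker (qbar : (sch₀Of 𝓜 w I.univ (red₀Of S Kc 𝓜 w h𝓨 e y)).X ⟶ (sch₀Of 𝓜 w (serreTensor I.act E' hE') (red₀Of S Kc 𝓜 w h𝓨 e y'')).X))) =
      I.pChar ^ I.fDeg * I.pChar ^ I.fDeg :=
  hRK.trans (natCard_kerPoints_eq_mul_self_of_forall_iff_of_natCard_eq_pow_two_mul q K r1 hcardK)

end K4Seam

section K2Row

open scoped MonObj CategoryTheory.Obj

set_option maxHeartbeats 400000 in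
/-- **(K2-gen) ROW OF `stub_RHO1` FROM THE KERNEL ROWS** (closes (G2)): socket text be4dc9fa :1143–:1149 token for token with `ψ := q̄` read at the heads' type; inputs (r1), `hKtors`
(§K `isIdealTorsionΩ_mul_of_roofLink`), ★'s (K2-gen) row `hK2`. [cite: Liu2021, Prop. D.8 (2) p. 135] [cite: SerreTate1968, §1 Lemma 2] [cite: MumfordAV1970, §7 Thm. 4 (p. 72)] -/
theorem k2_row_of_kerRow (I : RGDInputsAt F ι₁ Jstar K₀ S hU7ₛ hJ hJu Fi Kc G 𝓜 w hw h𝓨 θ e)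
    {m : ℕ} (E' : Matrix (Fin m) (Fin m) (𝓞 F)) (hE' : E' * E' = E')
    (y y'' : AlgPoints (S.M.obj Kc) (AlgebraicClosure (w.adicCompletion F))) (L : LineOf I y)
    {B : AbelianSchemeOver (Spec (CommRingCat.of (AlgebraicClosure (w.adicCompletion F))))}
    (q : (schΩOf S Kc 𝓜 w e I.univ y).X ⟶ B.X)
    (K : Subgroup ((fibreΩOf S Kc 𝓜 w e I.univ y).Points (AlgebraicClosure (w.adicCompletion F))))
    (r1 : ∀ P : (fibreΩOf S Kc 𝓜 w e I.univ y).Points (AlgebraicClosure (w.adicCompletion F)),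
      (AlgPoints.map q P : B.toAffine.toAbelianVariety.Points (AlgebraicClosure (w.adicCompletion F))) = 1 ↔ P ∈ K)
    (hKtors : ∀ P ∈ K, IsIdealTorsionΩ S Kc 𝓜 w e I.univ I.act y (w.asIdeal * ((IsCMField.complexConj F) • w).asIdeal) P)
    -- `q̄` in ★'s ∕ W1-a's spelling
    (qbar : haveI := I.comm
      haveI : IsProper (𝓜.localise w).total.hom := h𝓨.2
      ((I.univ.baseChange (pullback.fst (𝓜.localise w).total.hom (specResidueField w))).baseChange ((𝓜.localise w).geomReductionMap (thickeningLift e (S.M.obj Kc) y)).left).X ⟶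
        (((serreTensor I.act E' hE').baseChange (pullback.fst (𝓜.localise w).total.hom (specResidueField w))).baseChange ((𝓜.localise w).geomReductionMap (thickeningLift e (S.M.obj Kc) y'')).left).X)
    -- the (K2-gen) row of ★ p850352 ∕ W1-a head′
    (hK2 : haveI := I.comm
      haveI : IsProper (𝓜.localise w).total.hom := h𝓨.2
      ∀ 𝔞 : Ideal (𝓞 F),
        (∀ Pt : ((I.univ.baseChange ((𝓜.localise w).genericIso'.inv.left ≫ pullback.fst (𝓜.localise w).total.hom (specGenericPoint (HeightOneSpectrum.valuationSubringAtPrime F w) F))).baseChange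
            (thickeningLift e (S.M.obj Kc) y).left).toAffine.toAbelianVariety.Points (AlgebraicClosure (w.adicCompletion F)),
          (AlgPoints.map q Pt : B.toAffine.toAbelianVariety.Points (AlgebraicClosure (w.adicCompletion F))) = 1 →
            ∀ r ∈ 𝔞, (AlgPoints.map (((I.act.baseChange ((𝓜.localise w).genericIso'.inv.left ≫ pullback.fst (𝓜.localise w).total.hom (specGenericPoint (HeightOneSpectrum.valuationSubringAtPrime F w) F))).baseChange (thickeningLift e (S.M.obj Kc) y).left).i r) Pt :
              ((I.univ.baseChange ((𝓜.localise w).genericIso'.inv.left ≫ pullback.fst (𝓜.localise w).total.hom (specGenericPoint (HeightOneSpectrum.valuationSubringAtPrime F w) F))).baseChange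
                (thickeningLift e (S.M.obj Kc) y).left).toAffine.toAbelianVariety.Points (AlgebraicClosure (w.adicCompletion F))) = 1) →
        ∀ ⦃T : Over (Spec (.of (geomResidueField w)))⦄ (z : T ⟶ ((I.univ.baseChange (pullback.fst (𝓜.localise w).total.hom (specResidueField w))).baseChange ((𝓜.localise w).geomReductionMap (thickeningLift e (S.M.obj Kc) y)).left).X),
          z ≫ qbar = 1 → ∀ r ∈ 𝔞, z ≫ ((I.act.baseChange (pullback.fst (𝓜.localise w).total.hom (specResidueField w))).baseChange ((𝓜.localise w).geomReductionMap (thickeningLift e (S.M.obj Kc) y)).left).i r = 1) :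
    haveI := I.comm
    ∀ 𝔞 : Ideal (𝓞 F), (∀ Pt ∈ L.1, IsIdealTorsionΩ S Kc 𝓜 w e I.univ I.act y 𝔞 Pt) →
      (∀ Pt : (fibreΩOf S Kc 𝓜 w e I.univ y).Points (AlgebraicClosure (w.adicCompletion F)),
        (∀ r ∈ w.asIdeal * ((IsCMField.complexConj F) • w).asIdeal, (AlgPoints.map (actΩOf S Kc 𝓜 w e I.univ I.act r y).hom.hom.hom Pt :
          (fibreΩOf S Kc 𝓜 w e I.univ y).Points (AlgebraicClosure (w.adicCompletion F))) = 1) → IsIdealTorsionΩ S Kc 𝓜 w e I.univ I.act y 𝔞 Pt) →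
      ∀ ⦃T : SchemeOver (geomResidueField w)⦄ (z : T ⟶ (sch₀Of 𝓜 w I.univ (red₀Of S Kc 𝓜 w h𝓨 e y)).X),
        z ≫ (qbar : (sch₀Of 𝓜 w I.univ (red₀Of S Kc 𝓜 w h𝓨 e y)).X ⟶ (sch₀Of 𝓜 w (serreTensor I.act E' hE') (red₀Of S Kc 𝓜 w h𝓨 e y'')).X) = 1 →
          ∀ r ∈ 𝔞, z ≫ (act₀Of 𝓜 w I.univ I.act r (red₀Of S Kc 𝓜 w h𝓨 e y)).hom.hom.hom = 1 :=
  fun 𝔞 _ h2 => hK2 𝔞 (fun Pt hPt => h2 Pt (hKtors Pt ((r1 Pt).1 hPt)))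

end K2Row

section RKRow

open scoped MonObj CategoryTheory.Obj
open Literature.AlgebraicGeometry.GroupSchemes (GroupSchemeKernel.ker finrank_alg_realisation_eq_of_finrank_ker_eq)

set_option maxHeartbeats 400000 in
/-- **(RK) ROW OF `stub_RHO1` FROM THE KERNEL ROWS.**  For the roof leg `q : A_y → B` with (r1) `Ker q(Ω̄) = K`, `#K = p^{2f}` (`hcardK`), and the reduced leg `q̄` (★ p850352 ∕ W1-a
head′ type) with its (RK) row `hRK : rk_κ̄ Γ(Ker q̄) = #Ker q(Ω̄)`: EVERY closed realisation `κ : K′ ↪ A_{red₀ y}` of `Ker q̄` (★ p850575's binder list) has `rk_κ̄ Γ(K′) = p^f · p^f` — the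
(RK) conjunct of `stub_RHO1` (be4dc9fa :1150–:1154) token for token, `ψ := q̄` at the heads' type. [cite: MumfordAV1970, §7 Thm. 4 (p. 72)] [cite: Liu2021, Prop. D.8 (2)(3) p. 135]
[cite: Tate1997FiniteFlatGroupSchemes, (3.7)] -/
theorem rk_row_of_kerRow (I : RGDInputsAt F ι₁ Jstar K₀ S hU7ₛ hJ hJu Fi Kc G 𝓜 w hw h𝓨 θ e)
    {m : ℕ} (E' : Matrix (Fin m) (Fin m) (𝓞 F)) (hE' : E' * E' = E')
    (y y'' : AlgPoints (S.M.obj Kc) (AlgebraicClosure (w.adicCompletion F)))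
    {B : AbelianSchemeOver (Spec (CommRingCat.of (AlgebraicClosure (w.adicCompletion F))))}
    (q : (schΩOf S Kc 𝓜 w e I.univ y).X ⟶ B.X) [IsMonHom q]
    (K : Subgroup ((fibreΩOf S Kc 𝓜 w e I.univ y).Points (AlgebraicClosure (w.adicCompletion F))))
    (r1 : ∀ P : (fibreΩOf S Kc 𝓜 w e I.univ y).Points (AlgebraicClosure (w.adicCompletion F)),
      (AlgPoints.map q P : B.toAffine.toAbelianVariety.Points (AlgebraicClosure (w.adicCompletion F))) = 1 ↔ P ∈ K)
    (hcardK : Nat.card ↥K = I.pChar ^ (2 * I.fDeg))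
    -- `q̄` in ★'s ∕ W1-a's spelling
    (qbar : haveI := I.comm
      haveI : IsProper (𝓜.localise w).total.hom := h𝓨.2
      ((I.univ.baseChange (pullback.fst (𝓜.localise w).total.hom (specResidueField w))).baseChange ((𝓜.localise w).geomReductionMap (thickeningLift e (S.M.obj Kc) y)).left).X ⟶
        (((serreTensor I.act E' hE').baseChange (pullback.fst (𝓜.localise w).total.hom (specResidueField w))).baseChange ((𝓜.localise w).geomReductionMap (thickeningLift e (S.M.obj Kc) y'')).left).X)
    -- the (RK) row of ★ p850352 ∕ W1-a head′
    (hRK : haveI := I.comm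
      haveI : IsProper (𝓜.localise w).total.hom := h𝓨.2
      Module.finrank (geomResidueField w) (Alg (GroupSchemeKernel.ker qbar)) =
        Nat.card (Literature.AlgebraicGeometry.Motives.AbelianVariety.Hom.kerPoints
          (specOver (AlgebraicClosure (w.adicCompletion F)) (AlgebraicClosure (w.adicCompletion F))) (homOfIsMonHom q))) :
    haveI := I.comm
    ∀ (K' : SchemeOver (geomResidueField w)) [GrpObj K'] [IsAffine K'.left] [Module.Finite (geomResidueField w) (Alg K')]
      (κ : K' ⟶ (sch₀Of 𝓜 w I.univ (red₀Of S Kc 𝓜 w h𝓨 e y)).X) [IsMonHom κ] [IsClosedImmersion κ.left],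
      (∀ ⦃T : SchemeOver (geomResidueField w)⦄ (t : T ⟶ (sch₀Of 𝓜 w I.univ (red₀Of S Kc 𝓜 w h𝓨 e y)).X), (∃ s : T ⟶ K', s ≫ κ = t) ↔
        t ≫ (qbar : (sch₀Of 𝓜 w I.univ (red₀Of S Kc 𝓜 w h𝓨 e y)).X ⟶ (sch₀Of 𝓜 w (serreTensor I.act E' hE') (red₀Of S Kc 𝓜 w h𝓨 e y'')).X) = 1) →
      Module.finrank (geomResidueField w) (Alg K') = I.pChar ^ I.fDeg * I.pChar ^ I.fDeg := by
  intro K' _ _ _ κ _ _ hK'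
  haveI := I.comm
  exact finrank_alg_realisation_eq_of_finrank_ker_eq
    (qbar : (sch₀Of 𝓜 w I.univ (red₀Of S Kc 𝓜 w h𝓨 e y)).X ⟶ (sch₀Of 𝓜 w (serreTensor I.act E' hE') (red₀Of S Kc 𝓜 w h𝓨 e y'')).X)
    (hRK.trans (natCard_kerPoints_eq_mul_self_of_forall_iff_of_natCard_eq_pow_two_mul q K r1 hcardK)) K' κ hK'

end RKRow

section KillRow

open scoped MonObj CategoryTheory.Obj

end KillRow

end QuotLegReduction

end Summit.HodgeConjecture.HodgeConjecture.Cruxes.HLiu418.F0P6aLineSpecialisation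

end
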